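import Summits.CriticalPhenomena.PercolationContinuityZ3.Theorems.PercNearOneGluingNoHeavyLowerTailQ44SingleSourceFrontier
import Summits.CriticalPhenomena.PercolationContinuityZ3.Theorems.PercNearOneGluingNoHeavyLowerTailNineTypeKernelsAll
import Summits.CriticalPhenomena.PercolationContinuityZ3.Theorems.PercNearOneGluingNoHeavyLowerTailQ44bCrossPendantExchange
import HarnessLib

/-!
# The `Q44` single-source packing law for EVERY finite weighted graph (all `n`) — by an exact certificate over
# kernel theorems and two BHK rows

Support file for crux `stmt-CriticalPhenomena-4575` (master-family programme, row `Q44`; the FULL single-source packing of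
`prim-bnk-1` gens 26–33, hitherto open for all `n`: the tree had it from the fibre hypothesis MONO-A (`pack_singleSource_of_monoA`),
from the law-level pencil hypotheses (`SingleSourceLaw.law_nonneg_of_eMonoA/_of_mixA`, seat `prim-l12-p6` gen 24) and its two
six-term parts `pack_singleSource_a_minus_K4s/_K5` unconditionally), seat `prim-l12-p6` gen 24; memo
`run/shared/lean/prim/prim-l12/FROM-prim-l12-p6-g24-EMONOA-SOCKET.md` §3D.

**Theorem (`SingleSourceLaw.pack_singleSource`).**  For `μ = prodBernoulli w` on the pairs of `Fin n` and all
`a b c y`, with `cᵢ = FourPointAtoms.cell w a b c y i`: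
`c₆c₇ + c₅c₇ + c₁₁c₉ + c₁₁c₈ + c₆c₈ + c₆c₁ + c₈c₁ ≤ (c₁₁ + c₁₄)·c₀`, i.e.
`P(ab|c|y)P(a|bcy) + P(ac|b|y)P(a|bcy) + P(ab|cy)P(ac|by) + P(ab|cy)P(ay|bc) + P(ab|c|y)P(ay|bc) + P(ab|c|y)P(a|b|cy) + P(ay|bc)P(a|b|cy)
 ≤ [P(ab|cy)+P(abcy)]·P(a|b|c|y)`.

PROOF = the exact degree-3 certificate found by column generation over {kernel theorems of the family} ∪ {Harris, BHK 2006 Thm 2.1 rows}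
(kit j198416 / j198465, sparsified to 8 columns, verified in exact arithmetic in the seat, `work/py/cert_exact.py`):
with `ℓ = c₀ + c₁ + c₂ + c₄ + c₉ + c₁₀`,
  `ℓ · LAW = c₂·(LAW−K4s) + (c₉+c₁₀)·(LAW−K5) + (c₀+c₁+c₄)·Q44b₉ + c₄·R_A + c₁·R_B + [c₀c₆c₉ + c₀c₆c₁₀ + c₂c₃c₄ + c₂c₄c₈ + c₄c₆c₉ + c₄c₆c₁₀]`
as a polynomial identity in the fifteen cells (`ring`), where
* `LAW−K4s`, `LAW−K5 ≥ 0` are `TwoCopyMono.pack_singleSource_a_minus_K4s/_K5` (prim-bnk-1 gen 27, nine-type label certificates),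
* `Q44b₉ ≥ 0` is `TwoCopyMono.q44b_pack_nine` (prim-bnk-1 gen 19, the nine-type count),
* `R_A ≥ 0`: given `{a} ↮ {b,c}`, the increasing events `{b~c}` and `{y~b ∨ y~c}` of `C_{b,c}` are positively correlated
  (`(c₃+c₇+c₈)(c₁+c₂+c₇) ≤ c₇·(c₀+c₁+c₂+c₃+c₄+c₇+c₈)`), and
* `R_B ≥ 0`: given `{a} ↮ {b,c}`, `{a~y}` (a function of `C_a`) and `{b~c}` (of `C_{b,c}`) are negatively correlated
  (`(c₀+…+c₈)_D · c₈ ≤ (c₄+c₈)(c₃+c₇+c₈)`) — both instances of the tree's set form of van den Berg–Häggström–Kahn 2006 Thm 2.1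
  (`setClusterEventExchange`), converted to cells with the four-point dictionary;
* the degenerate case `ℓ = 0` forces `c₀ = 0`, and every side product is `≤ c₀` (`cell_mul_cell_le_cell_zero`: Harris for the two
  decreasing hulls of the cells, whose intersection is the all-separated event), so `LAW = 0` there.
Consequences: a MONO-A-free, E-MONO-A-free proof of the law; the named sockets of `…Q44SingleSourceEMonoA` (`law_nonneg_of_eMonoA/_of_mixA`) are thereby
bypassed (E-MONO-A / MIX-A themselves stay open; `0 ≤ SingleSourceLaw.law` is `pack_singleSource` after `unfold law bil; linarith`).  No sorries, no new
definitions, standard axioms.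
-/

noncomputable section

namespace Summit.CriticalPhenomena.PercolationContinuityZ3.Theorems

namespace SingleSourceLaw

open MeasureTheory Set Literature.Probability.Percolation
open Literature.Probability.LatticeModels (prodBernoulli prodBernoulli_harris_lower)
open Summit.CriticalPhenomena.PercolationContinuityZ3.Cruxes.AdditiveGluing.TieLine.ConnAtoms
open FourPointAtoms Q44bExchange

variable {V : Type*} [Fintype V]

/-! ### The two BHK rows, event form -/

omit [Fintype V] in
/-- The separation event `{b,c} ↮ {a}` written with `openConn a ·`. [folklore] -/
theorem setOf_sep_bc_a (a b c : V) :
    {ω : BondConfig V | ∀ s ∈ ({b, c} : Set V), ∀ t ∈ ({a} : Set V), ¬ (openGraph ω).Reachable s t} =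
      (openConn a b)ᶜ ∩ (openConn a c)ᶜ := by
  ext ω
  simp only [mem_setOf_eq, mem_insert_iff, mem_singleton_iff, forall_eq_or_imp, forall_eq, mem_inter_iff, mem_compl_iff,
    openConn]
  constructor
  · rintro ⟨h1, h2⟩; exact ⟨fun h => h1 h.symm, fun h => h2 h.symm⟩
  · rintro ⟨h1, h2⟩; exact ⟨fun h => h1 h.symm, fun h => h2 h.symm⟩

/-- **Row A (event form)**: given `{a} ↮ {b,c}`, `{b~c}` and `{y~b ∨ y~c}` (increasing events of `C_{b,c}`) are positively
correlated: `μ(D∩bc)·μ(D∩(by∪cy)) ≤ μ(D∩(bc∩(by∪cy)))·μ(D)`, `D = {a≁b}∩{a≁c}`.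
[cite: VandenbergHaggstromKahn2005, Thm. 2.1 (p. 9) at q = 1 — corollary] -/
theorem rowA_events (w : Sym2 V → unitInterval) (a b c y : V) :
    (prodBernoulli w).real ((openConn a b)ᶜ ∩ (openConn a c)ᶜ ∩ openConn b c) *
        (prodBernoulli w).real ((openConn a b)ᶜ ∩ (openConn a c)ᶜ ∩ (openConn b y ∪ openConn c y)) ≤
      (prodBernoulli w).real ((openConn a b)ᶜ ∩ (openConn a c)ᶜ ∩ (openConn b c ∩ (openConn b y ∪ openConn c y))) *
        (prodBernoulli w).real ((openConn a b)ᶜ ∩ (openConn a c)ᶜ) := by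
  classical
  have hb : b ∈ ({b, c} : Set V) := by simp
  have hc : c ∈ ({b, c} : Set V) := by simp
  have key := setClusterEventExchange w ({b, c} : Set V) ({a} : Set V)
    (fun C => (SimpleGraph.fromEdgeSet C).Reachable b c)
    (fun C => (SimpleGraph.fromEdgeSet C).Reachable b y ∨ (SimpleGraph.fromEdgeSet C).Reachable c y)
    (fun _ => True) (fun _ => True)
    (PathExchange.reachIn_mono b c)
    (fun C C' hCC' h => h.imp (fun h' => PathExchange.reachIn_mono b y hCC' h') (fun h' => PathExchange.reachIn_mono c y hCC' h'))
    (fun _ _ _ h => h) (fun _ _ _ h => h)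
  have hor : {ω : BondConfig V | (SimpleGraph.fromEdgeSet (⋃ s ∈ ({b, c} : Set V), openEdgeCluster ω s)).Reachable b y ∨
      (SimpleGraph.fromEdgeSet (⋃ s ∈ ({b, c} : Set V), openEdgeCluster ω s)).Reachable c y} = openConn b y ∪ openConn c y := by
    rw [← setOf_fromEdgeSet_biUnion_reachable _ hb y, ← setOf_fromEdgeSet_biUnion_reachable _ hc y]; rfl
  simp only [setOf_fromEdgeSet_biUnion_reachable _ hb, hor, setOf_true, inter_univ, setOf_sep_bc_a] at key
  exact key

/-- **Row B (event form)**: given `{a} ↮ {b,c}`, `{a~y}` (a function of `C_a`) and `{b~c}` (of `C_{b,c}`) are negatively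
correlated: `μ(D∩(ay∩bc))·μ(D) ≤ μ(D∩ay)·μ(D∩bc)`. [cite: VandenbergHaggstromKahn2005, Thm. 2.1 (p. 9) at q = 1 — corollary] -/
theorem rowB_events (w : Sym2 V → unitInterval) (a b c y : V) :
    (prodBernoulli w).real ((openConn a b)ᶜ ∩ (openConn a c)ᶜ ∩ (openConn a y ∩ openConn b c)) *
        (prodBernoulli w).real ((openConn a b)ᶜ ∩ (openConn a c)ᶜ) ≤
      (prodBernoulli w).real ((openConn a b)ᶜ ∩ (openConn a c)ᶜ ∩ openConn a y) *
        (prodBernoulli w).real ((openConn a b)ᶜ ∩ (openConn a c)ᶜ ∩ openConn b c) := by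
  classical
  have ha : a ∈ ({a} : Set V) := by simp
  have hb : b ∈ ({b, c} : Set V) := by simp
  have key := setClusterEventExchange w ({a} : Set V) ({b, c} : Set V)
    (fun C => (SimpleGraph.fromEdgeSet C).Reachable a y) (fun _ => True)
    (fun C => (SimpleGraph.fromEdgeSet C).Reachable b c) (fun _ => True)
    (PathExchange.reachIn_mono a y) (fun _ _ _ h => h)
    (PathExchange.reachIn_mono b c) (fun _ _ _ h => h)
  have hD : {ω : BondConfig V | ∀ s ∈ ({a} : Set V), ∀ t ∈ ({b, c} : Set V), ¬ (openGraph ω).Reachable s t} =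
      (openConn a b)ᶜ ∩ (openConn a c)ᶜ := by
    ext ω
    simp only [mem_setOf_eq, mem_insert_iff, mem_singleton_iff, forall_eq_or_imp, forall_eq, mem_inter_iff, mem_compl_iff,
      openConn]
  simp only [setOf_fromEdgeSet_biUnion_reachable _ ha, setOf_fromEdgeSet_biUnion_reachable _ hb, setOf_true, inter_univ,
    hD] at key
  exact key

/-! ### The two BHK rows in cells -/

section cells

variable (w : Sym2 V → unitInterval) (a b c y : V)

/-- `μ(D ∩ {b~c})` in cells. [this work] -/
theorem real_D_bc : (prodBernoulli w).real ((openConn a b)ᶜ ∩ (openConn a c)ᶜ ∩ openConn b c) =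
    cell w a b c y 3 + cell w a b c y 7 + cell w a b c y 8 := by
  rw [measureReal_eq_cellSum w a b c y (show HasPattern (quad a b c y) ((openConn a b)ᶜ ∩ (openConn a c)ᶜ ∩ openConn b c) _ from
    (((oc a b c y 0 1 rfl rfl).compl.inter (oc a b c y 0 2 rfl rfl).compl).inter (oc a b c y 1 2 rfl rfl)))]
  simp (config := {decide := true}) only [ite_true, ite_false]; ring

/-- `μ(D ∩ ({b~y} ∪ {c~y}))` in cells. [this work] -/
theorem real_D_yT : (prodBernoulli w).real ((openConn a b)ᶜ ∩ (openConn a c)ᶜ ∩ (openConn b y ∪ openConn c y)) =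
    cell w a b c y 1 + cell w a b c y 2 + cell w a b c y 7 := by
  rw [measureReal_eq_cellSum w a b c y (show HasPattern (quad a b c y)
      ((openConn a b)ᶜ ∩ (openConn a c)ᶜ ∩ (openConn b y ∪ openConn c y)) _ from
    (((oc a b c y 0 1 rfl rfl).compl.inter (oc a b c y 0 2 rfl rfl).compl).inter
      ((oc a b c y 1 3 rfl rfl).union (oc a b c y 2 3 rfl rfl))))]
  simp (config := {decide := true}) only [ite_true, ite_false]; ring

/-- `μ(D ∩ {b~c} ∩ ({b~y} ∪ {c~y}))` in cells. [this work] -/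
theorem real_D_bc_yT :
    (prodBernoulli w).real ((openConn a b)ᶜ ∩ (openConn a c)ᶜ ∩ (openConn b c ∩ (openConn b y ∪ openConn c y))) =
      cell w a b c y 7 := by
  rw [measureReal_eq_cellSum w a b c y (show HasPattern (quad a b c y)
      ((openConn a b)ᶜ ∩ (openConn a c)ᶜ ∩ (openConn b c ∩ (openConn b y ∪ openConn c y))) _ from
    (((oc a b c y 0 1 rfl rfl).compl.inter (oc a b c y 0 2 rfl rfl).compl).inter
      ((oc a b c y 1 2 rfl rfl).inter ((oc a b c y 1 3 rfl rfl).union (oc a b c y 2 3 rfl rfl)))))]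
  simp (config := {decide := true}) only [ite_true, ite_false]; ring

/-- `μ(D ∩ {a~y})` in cells. [this work] -/
theorem real_D_ay : (prodBernoulli w).real ((openConn a b)ᶜ ∩ (openConn a c)ᶜ ∩ openConn a y) =
    cell w a b c y 4 + cell w a b c y 8 := by
  rw [measureReal_eq_cellSum w a b c y (show HasPattern (quad a b c y) ((openConn a b)ᶜ ∩ (openConn a c)ᶜ ∩ openConn a y) _ from
    (((oc a b c y 0 1 rfl rfl).compl.inter (oc a b c y 0 2 rfl rfl).compl).inter (oc a b c y 0 3 rfl rfl)))]
  simp (config := {decide := true}) only [ite_true, ite_false]; ring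

/-- `μ(D ∩ {a~y} ∩ {b~c})` in cells. [this work] -/
theorem real_D_ay_bc : (prodBernoulli w).real ((openConn a b)ᶜ ∩ (openConn a c)ᶜ ∩ (openConn a y ∩ openConn b c)) =
    cell w a b c y 8 := by
  rw [measureReal_eq_cellSum w a b c y (show HasPattern (quad a b c y)
      ((openConn a b)ᶜ ∩ (openConn a c)ᶜ ∩ (openConn a y ∩ openConn b c)) _ from
    (((oc a b c y 0 1 rfl rfl).compl.inter (oc a b c y 0 2 rfl rfl).compl).inter
      ((oc a b c y 0 3 rfl rfl).inter (oc a b c y 1 2 rfl rfl))))]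
  simp (config := {decide := true}) only [ite_true, ite_false]; ring

/-- **Row A in cells**: `(c₃+c₇+c₈)(c₁+c₂+c₇) ≤ c₇·(c₀+c₁+c₂+c₃+c₄+c₇+c₈)`. [this work] -/
theorem rowA : (cell w a b c y 3 + cell w a b c y 7 + cell w a b c y 8) * (cell w a b c y 1 + cell w a b c y 2 + cell w a b c y 7) ≤
    cell w a b c y 7 * (cell w a b c y 0 + cell w a b c y 1 + cell w a b c y 2 + cell w a b c y 3 + cell w a b c y 4 +
      cell w a b c y 7 + cell w a b c y 8) := by
  have h := rowA_events w a b c y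
  rw [real_D_bc, real_D_yT, real_D_bc_yT, real_shk_AB] at h
  exact h

/-- **Row B in cells**: `c₈·(c₀+c₁+c₂+c₃+c₄+c₇+c₈) ≤ (c₄+c₈)(c₃+c₇+c₈)`. [this work] -/
theorem rowB : cell w a b c y 8 * (cell w a b c y 0 + cell w a b c y 1 + cell w a b c y 2 + cell w a b c y 3 + cell w a b c y 4 +
      cell w a b c y 7 + cell w a b c y 8) ≤
    (cell w a b c y 4 + cell w a b c y 8) * (cell w a b c y 3 + cell w a b c y 7 + cell w a b c y 8) := by
  have h := rowB_events w a b c y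
  rw [real_D_ay_bc, real_shk_AB, real_D_ay, real_D_bc] at h
  exact h

/-! ### Side products are bounded by the all-separated cell -/

omit [Fintype V] in
/-- The decreasing hull of a pattern: every pair the pattern separates is separated. [this work] -/
theorem isLowerSet_hull (i : Fin 15) :
    IsLowerSet {ω : BondConfig V | ∀ s t : Fin 4, pat4 i s ≠ pat4 i t → ¬ (openGraph ω).Reachable (quad a b c y s) (quad a b c y t)} := by
  intro ω ω' hle hω s t hst hR
  exact hω s t hst (hR.mono (openGraph_mono hle))

omit [Fintype V] in
/-- A cell lies inside its decreasing hull. [this work] -/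
theorem cell_le_hull (i : Fin 15) :
    cell w a b c y i ≤ (prodBernoulli w).real
      {ω : BondConfig V | ∀ s t : Fin 4, pat4 i s ≠ pat4 i t → ¬ (openGraph ω).Reachable (quad a b c y s) (quad a b c y t)} := by
  unfold cell
  exact measureReal_mono fun ω hω s t hst hR => hst (((mem_atom _).1 hω s t).1 hR)

/-- **`cell p · cell q ≤ cell ⊥`** whenever no pair of marked points is joined in both patterns (the seven single-source
types qualify): Harris for the two decreasing hulls, whose intersection is the all-separated cell. [this work] -/
theorem cell_mul_cell_le_cell_zero (i j : Fin 15)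
    (h : ∀ s t : Fin 4, s ≠ t → (pat4 i s ≠ pat4 i t ∨ pat4 j s ≠ pat4 j t)) :
    cell w a b c y i * cell w a b c y j ≤ cell w a b c y 0 := by
  classical
  set Ei := {ω : BondConfig V | ∀ s t : Fin 4, pat4 i s ≠ pat4 i t → ¬ (openGraph ω).Reachable (quad a b c y s) (quad a b c y t)}
  set Ej := {ω : BondConfig V | ∀ s t : Fin 4, pat4 j s ≠ pat4 j t → ¬ (openGraph ω).Reachable (quad a b c y s) (quad a b c y t)}
  have hmeas : ∀ E : Set (BondConfig V), MeasurableSet E := fun _ => MeasurableSet.of_discrete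
  have hH := prodBernoulli_harris_lower w (isLowerSet_hull a b c y i) (isLowerSet_hull a b c y j) (hmeas Ei) (hmeas Ej)
  have hsub : (prodBernoulli w).real (Ei ∩ Ej) ≤ cell w a b c y 0 := by
    unfold cell
    refine measureReal_mono fun ω hω => (mem_atom _).2 fun s t => ?_
    constructor
    · intro hR
      by_contra hne
      have hst : s ≠ t := fun hh => hne (by rw [hh])
      rcases h s t hst with hi | hj
      · exact hω.1 s t hi hR
      · exact hω.2 s t hj hR
    · intro hst
      have : s = t := by revert hst; revert s t; decide
      subst this
      exact SimpleGraph.Reachable.refl _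
  calc cell w a b c y i * cell w a b c y j
      ≤ (prodBernoulli w).real Ei * (prodBernoulli w).real Ej :=
        mul_le_mul (cell_le_hull w a b c y i) (cell_le_hull w a b c y j) (cell_nonneg w a b c y j) measureReal_nonneg
    _ ≤ (prodBernoulli w).real (Ei ∩ Ej) := hH
    _ ≤ cell w a b c y 0 := hsub

end cells

/-! ### The law for every finite weighted graph -/

variable {n : ℕ}

/-- **The `Q44` single-source packing, all `n`, unconditionally** — the conclusion of `TwoCopyMono.pack_singleSource_of_monoA`
(prim-bnk-1 gen 32) and of `SingleSourceLaw.pack_singleSource_of_eMonoA/_of_mixA` (prim-l12-p6 gen 24) WITHOUT their hypotheses: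
`P(ab|c|y)P(a|bcy) + P(ac|b|y)P(a|bcy) + P(ab|cy)P(ac|by) + P(ab|cy)P(ay|bc) + P(ab|c|y)P(ay|bc) + P(ab|c|y)P(a|b|cy) + P(ay|bc)P(a|b|cy)
≤ [P(ab|cy)+P(abcy)]·P(a|b|c|y)` on every finite weighted graph on `Fin n`.  Proof: the exact certificate
`ℓ·LAW = c₂(LAW−K4s) + (c₉+c₁₀)(LAW−K5) + (c₀+c₁+c₄)·Q44b₉ + c₄R_A + c₁R_B + (six cubic monomials)` (`ring`) over the kernel theorems
`pack_singleSource_a_minus_K4s/_K5`, `q44b_pack_nine` and the BHK rows `rowA`, `rowB`; the degenerate case `ℓ = 0` forces `c₀ = 0` and then every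
side vanishes (`cell_mul_cell_le_cell_zero`). [this work] -/
theorem pack_singleSource (w : Sym2 (Fin n) → unitInterval) (a b c y : Fin n) :
    cell w a b c y 6 * cell w a b c y 7 +
      cell w a b c y 5 * cell w a b c y 7 +
      cell w a b c y 11 * cell w a b c y 9 +
      cell w a b c y 11 * cell w a b c y 8 +
      cell w a b c y 6 * cell w a b c y 8 +
      cell w a b c y 6 * cell w a b c y 1 +
      cell w a b c y 8 * cell w a b c y 1 ≤
      (cell w a b c y 11 + cell w a b c y 14) * cell w a b c y 0 := by
  have hK4s := TwoCopyMono.pack_singleSource_a_minus_K4s w a b c y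
  have hK5 := TwoCopyMono.pack_singleSource_a_minus_K5 w a b c y
  have hQ := TwoCopyMono.q44b_pack_nine w a b c y
  have hA := rowA w a b c y
  have hB := rowB w a b c y
  have c0 := cell_nonneg w a b c y 0
  have c1 := cell_nonneg w a b c y 1
  have c2 := cell_nonneg w a b c y 2
  have c3 := cell_nonneg w a b c y 3
  have c4 := cell_nonneg w a b c y 4
  have c6 := cell_nonneg w a b c y 6
  have c8 := cell_nonneg w a b c y 8
  have c9 := cell_nonneg w a b c y 9
  have c10 := cell_nonneg w a b c y 10
  -- the certificate: ℓ · LAW ≥ 0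
  have e1 := mul_nonneg c2 (sub_nonneg.2 hK4s)
  have e2 := mul_nonneg (add_nonneg c9 c10) (sub_nonneg.2 hK5)
  have e3 := mul_nonneg (add_nonneg (add_nonneg c0 c1) c4) (sub_nonneg.2 hQ)
  have e4 := mul_nonneg c4 (sub_nonneg.2 hA)
  have e5 := mul_nonneg c1 (sub_nonneg.2 hB)
  have m1 := mul_nonneg (mul_nonneg c0 c6) c9
  have m2 := mul_nonneg (mul_nonneg c0 c6) c10
  have m3 := mul_nonneg (mul_nonneg c2 c3) c4
  have m4 := mul_nonneg (mul_nonneg c2 c4) c8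
  have m5 := mul_nonneg (mul_nonneg c4 c6) c9
  have m6 := mul_nonneg (mul_nonneg c4 c6) c10
  have key : (cell w a b c y 0 + cell w a b c y 1 + cell w a b c y 2 + cell w a b c y 4 + cell w a b c y 9 +
        cell w a b c y 10) * ((cell w a b c y 11 + cell w a b c y 14) * cell w a b c y 0 -
      (cell w a b c y 6 * cell w a b c y 7 + cell w a b c y 5 * cell w a b c y 7 + cell w a b c y 11 * cell w a b c y 9 +
        cell w a b c y 11 * cell w a b c y 8 + cell w a b c y 6 * cell w a b c y 8 + cell w a b c y 6 * cell w a b c y 1 +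
        cell w a b c y 8 * cell w a b c y 1)) =
      cell w a b c y 2 * ((cell w a b c y 11 + cell w a b c y 14) * cell w a b c y 0 -
          (cell w a b c y 11 * cell w a b c y 9 + cell w a b c y 11 * cell w a b c y 8 + cell w a b c y 6 * cell w a b c y 8 +
            cell w a b c y 6 * cell w a b c y 1 + cell w a b c y 6 * cell w a b c y 7 + cell w a b c y 7 * cell w a b c y 5)) +
      (cell w a b c y 9 + cell w a b c y 10) * ((cell w a b c y 11 + cell w a b c y 14) * cell w a b c y 0 -
          (cell w a b c y 11 * cell w a b c y 9 + cell w a b c y 11 * cell w a b c y 8 + cell w a b c y 6 * cell w a b c y 8 +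
            cell w a b c y 1 * cell w a b c y 8 + cell w a b c y 7 * cell w a b c y 6 + cell w a b c y 7 * cell w a b c y 5)) +
      (cell w a b c y 0 + cell w a b c y 1 + cell w a b c y 4) * ((cell w a b c y 11 + cell w a b c y 14) * cell w a b c y 0 -
          (cell w a b c y 11 * (cell w a b c y 9 + cell w a b c y 8) +
            cell w a b c y 6 * (cell w a b c y 9 + cell w a b c y 8 + cell w a b c y 1 + cell w a b c y 10 + cell w a b c y 7) +
            cell w a b c y 7 * (cell w a b c y 5 + cell w a b c y 4))) +
      cell w a b c y 4 * (cell w a b c y 7 * (cell w a b c y 0 + cell w a b c y 1 + cell w a b c y 2 + cell w a b c y 3 +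
            cell w a b c y 4 + cell w a b c y 7 + cell w a b c y 8) -
          (cell w a b c y 3 + cell w a b c y 7 + cell w a b c y 8) * (cell w a b c y 1 + cell w a b c y 2 + cell w a b c y 7)) +
      cell w a b c y 1 * ((cell w a b c y 4 + cell w a b c y 8) * (cell w a b c y 3 + cell w a b c y 7 + cell w a b c y 8) -
          cell w a b c y 8 * (cell w a b c y 0 + cell w a b c y 1 + cell w a b c y 2 + cell w a b c y 3 + cell w a b c y 4 +
            cell w a b c y 7 + cell w a b c y 8)) +
      (cell w a b c y 0 * cell w a b c y 6 * cell w a b c y 9 + cell w a b c y 0 * cell w a b c y 6 * cell w a b c y 10 +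
        cell w a b c y 2 * cell w a b c y 3 * cell w a b c y 4 + cell w a b c y 2 * cell w a b c y 4 * cell w a b c y 8 +
        cell w a b c y 4 * cell w a b c y 6 * cell w a b c y 9 + cell w a b c y 4 * cell w a b c y 6 * cell w a b c y 10) := by
    ring
  have hcert : 0 ≤ (cell w a b c y 0 + cell w a b c y 1 + cell w a b c y 2 + cell w a b c y 4 + cell w a b c y 9 +
      cell w a b c y 10) * ((cell w a b c y 11 + cell w a b c y 14) * cell w a b c y 0 -
      (cell w a b c y 6 * cell w a b c y 7 + cell w a b c y 5 * cell w a b c y 7 + cell w a b c y 11 * cell w a b c y 9 +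
        cell w a b c y 11 * cell w a b c y 8 + cell w a b c y 6 * cell w a b c y 8 + cell w a b c y 6 * cell w a b c y 1 +
        cell w a b c y 8 * cell w a b c y 1)) := by
    rw [key]
    exact add_nonneg (add_nonneg (add_nonneg (add_nonneg (add_nonneg e1 e2) e3) e4) e5)
      (add_nonneg (add_nonneg (add_nonneg (add_nonneg (add_nonneg m1 m2) m3) m4) m5) m6)
  -- degenerate case: ℓ = 0 forces c₀ = 0 and then every side vanishes
  by_cases h0 : cell w a b c y 0 = 0
  · have s67 := cell_mul_cell_le_cell_zero w a b c y 6 7 (by decide)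
    have s57 := cell_mul_cell_le_cell_zero w a b c y 5 7 (by decide)
    have s119 := cell_mul_cell_le_cell_zero w a b c y 11 9 (by decide)
    have s118 := cell_mul_cell_le_cell_zero w a b c y 11 8 (by decide)
    have s68 := cell_mul_cell_le_cell_zero w a b c y 6 8 (by decide)
    have s61 := cell_mul_cell_le_cell_zero w a b c y 6 1 (by decide)
    have s81 := cell_mul_cell_le_cell_zero w a b c y 8 1 (by decide)
    rw [h0] at s67 s57 s119 s118 s68 s61 s81
    rw [h0, mul_zero]
    linarith [s67, s57, s119, s118, s68, s61, s81]
  · have hpos : 0 < cell w a b c y 0 + cell w a b c y 1 + cell w a b c y 2 + cell w a b c y 4 + cell w a b c y 9 +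
        cell w a b c y 10 := by
      have : 0 < cell w a b c y 0 := lt_of_le_of_ne c0 (Ne.symm h0)
      linarith
    have := (mul_nonneg_iff_of_pos_left hpos).mp hcert
    linarith

end SingleSourceLaw

end Summit.CriticalPhenomena.PercolationContinuityZ3.Theorems

end
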